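import Mathlib.Algebra.MvPolynomial.Basic
import Mathlib.Algebra.BigOperators.Fin
import Mathlib.Data.Complex.Basic
import Mathlib.Analysis.Convex.Extreme
import Mathlib.Data.Real.Basic
import Mathlib.Data.Set.Card
import HarnessLib

/-!
# REVIEW-RUNBOOK sanity lemmas — the sparsity / dissociation side conditions of the two KPTT-type
# counting theorems are jointly met (client `pub-kptt` of the ops review-runbook generator)

Card (2)(b) («non-vacuity») of `run/shared/lean/pub/pub-kptt/REVIEW-RUNBOOK.md`.  Both headline bounds
(`TwoProducts.Reduction.twoProducts_sparsity_le_two`, `NewtonUnitEquationsDissociatedUniform.dissociated_quasiPoly`)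
are stated under combinatorial side conditions on families of sparse polynomials; this file records, as
closed theorems `∃ objects, h₁ ∧ … ∧ hₙ` (the shape the generator's probe matches), explicit families
meeting them:

* `twoProducts_sparsity_le_two` (`t ≤ 2`, every `f j`, `g j` has `≤ t` monomials): `m = 2`, `t = 2`,
  `f = g = (X₀, X₁)` (one monomial each);
* `dissociated_quasiPoly` (`|A j| ≤ t`, `supp f i j ⊆ A j`, the exponent sets `A j` DISSOCIATED — a sum
  `∑ⱼ aⱼ` with `aⱼ ∈ A j` determines the `aⱼ`): `k = 1`, `m = 2`, `t = 1`, `A = ({x₀}, {x₁})` (the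
  exponent vectors of `X₀`, `X₁`), `f 0 = (X₀, X₁)`; dissociation holds because each `A j` is a
  singleton (the simplest dissociated family — larger ones, e.g. `A 0 = {x₀, x₀²}`, `A 1 = {x₁, x₁³}`,
  are dissociated by reading coordinates, not recorded here).

Review evidence only (`--supports`; the file closes no item); no definitions, no `sorry`, standard axioms.
-/

namespace Summit.ValiantsHypothesis.ValiantsHypothesis.Theorems.RunbookKPTT

open MvPolynomial

/-- `Xⱼ ∈ ℂ[X₀, X₁]` has exactly one monomial. [folklore] -/
theorem support_X_card (j : Fin 2) : ((X j : MvPolynomial (Fin 2) ℂ).support).card = 1 := by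
  rw [support_X, Finset.card_singleton]

/-- (b) **The three side conditions of `twoProducts_sparsity_le_two` hold together**: `m = 2`, `t = 2`,
`f = g = (X₀, X₁)` — every factor has `1 ≤ 2` monomials. [folklore] -/
theorem twoProducts_sparsity_le_two_hypotheses :
    ∃ (m t : ℕ) (f g : Fin m → MvPolynomial (Fin 2) ℂ),
      t ≤ 2 ∧ (∀ j, (f j).support.card ≤ t) ∧ (∀ j, (g j).support.card ≤ t) :=
  ⟨2, 2, fun j => X j, fun j => X j, le_rfl, fun j => by rw [support_X_card]; decide,
    fun j => by rw [support_X_card]; decide⟩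

/-- (b) **The three side conditions of `dissociated_quasiPoly` hold together**: `k = 1`, `m = 2`, `t = 1`,
`A = ({x₀}, {x₁})` (singleton exponent sets, `|A j| = 1 ≤ 1`), `f 0 j = Xⱼ` (`supp Xⱼ = {xⱼ} ⊆ A j`), and
the family is dissociated (`aⱼ, bⱼ ∈ A j = {xⱼ}` forces `a = b`, whatever the sums). [folklore] -/
theorem dissociated_quasiPoly_hypotheses :
    ∃ (k m t : ℕ) (A : Fin m → Finset (Fin 2 →₀ ℕ)) (f : Fin k → Fin m → MvPolynomial (Fin 2) ℂ),
      (∀ j, (A j).card ≤ t) ∧ (∀ i j, (f i j).support ⊆ A j) ∧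
        (∀ a b : Fin m → Fin 2 →₀ ℕ, (∀ j, a j ∈ A j) → (∀ j, b j ∈ A j) → ∑ j, a j = ∑ j, b j → a = b) := by
  refine ⟨1, 2, 1, fun j => {Finsupp.single j 1}, fun _ j => X j, fun j => by rw [Finset.card_singleton],
    fun i j => by rw [support_X], fun a b ha hb _ => funext fun j => ?_⟩
  rw [Finset.mem_singleton.1 (ha j), Finset.mem_singleton.1 (hb j)]

/-! ### The counted sets are FINITE (review-runbook 9.89 «written count» rows, 2026-09-04)

Both §1 statements bound `(Set.extremePoints ℝ (convexHull ℝ (exponent points of a support))).ncard` from ABOVE.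
`Set.ncard` of an INFINITE set is the default `0`, for which any upper bound holds for free; the bound is the
intended vertex count only because the counted set is finite — the extreme points of the convex hull of a
finite set lie in that set (`extremePoints_convexHull_subset`) and a support is a `Finset`.  Stated below for
the two counted sets EXACTLY as the statements print them (same binder names), and once for any polynomial. -/

/-- The vertex set of the Newton polygon of ANY bivariate polynomial `p` — the extreme points of the convex hull
of its exponent points in `ℝ²` — is finite: it is contained in the (finite) image of `p.support`. [folklore] -/
theorem extremePoints_newtonPolygon_finite (p : MvPolynomial (Fin 2) ℂ) :
    (Set.extremePoints ℝ (convexHull ℝ ((fun e : Fin 2 →₀ ℕ => fun i : Fin 2 => ((e i : ℕ) : ℝ)) ''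
      (p.support : Set (Fin 2 →₀ ℕ))))).Finite :=
  (p.support.finite_toSet.image _).subset extremePoints_convexHull_subset

/-- (c) **The set `twoProducts_sparsity_le_two` counts is finite** — for EVERY `m`, `f`, `g` (no sparsity
hypothesis needed): the vertices of `Newt(∏ f − ∏ g)` form a finite set, so the statement's `ncard` is the genuine
number of vertices and its upper bound `72·(m+1)²` is not the free bound at the default `0`. [folklore] -/
theorem twoProducts_vertexSet_finite (m : ℕ) (f g : Fin m → MvPolynomial (Fin 2) ℂ) :
    (Set.extremePoints ℝ (convexHull ℝ ((fun e : Fin 2 →₀ ℕ => fun i : Fin 2 => ((e i : ℕ) : ℝ)) ''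
      ((∏ j, f j - ∏ j, g j).support : Set (Fin 2 →₀ ℕ))))).Finite :=
  extremePoints_newtonPolygon_finite _

/-- (c) **The set `dissociated_quasiPoly` counts is finite** — for EVERY `k`, `m`, `f` (no frame hypothesis
needed): the vertices of `Newt(Σ_i ∏_j f i j)` form a finite set, so the statement's `ncard` is the genuine vertex
count. [folklore] -/
theorem dissociated_vertexSet_finite (k m : ℕ) (f : Fin k → Fin m → MvPolynomial (Fin 2) ℂ) :
    (Set.extremePoints ℝ (convexHull ℝ ((fun e : Fin 2 →₀ ℕ => fun i : Fin 2 => ((e i : ℕ) : ℝ)) ''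
      ((∑ i, ∏ j, f i j).support : Set (Fin 2 →₀ ℕ))))).Finite :=
  extremePoints_newtonPolygon_finite _

/-- The count is moreover at most the number of monomials: `#vert Newt(p) ≤ #supp p` (the vertex set injects into
the support's image). [folklore] -/
theorem ncard_extremePoints_newtonPolygon_le (p : MvPolynomial (Fin 2) ℂ) :
    (Set.extremePoints ℝ (convexHull ℝ ((fun e : Fin 2 →₀ ℕ => fun i : Fin 2 => ((e i : ℕ) : ℝ)) ''
      (p.support : Set (Fin 2 →₀ ℕ))))).ncard ≤ p.support.card := by
  calc (Set.extremePoints ℝ (convexHull ℝ ((fun e : Fin 2 →₀ ℕ => fun i : Fin 2 => ((e i : ℕ) : ℝ)) ''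
        (p.support : Set (Fin 2 →₀ ℕ))))).ncard
      ≤ ((fun e : Fin 2 →₀ ℕ => fun i : Fin 2 => ((e i : ℕ) : ℝ)) '' (p.support : Set (Fin 2 →₀ ℕ))).ncard :=
        Set.ncard_le_ncard extremePoints_convexHull_subset (p.support.finite_toSet.image _)
    _ ≤ (p.support : Set (Fin 2 →₀ ℕ)).ncard := Set.ncard_image_le p.support.finite_toSet
    _ = p.support.card := Set.ncard_coe_finset _

end Summit.ValiantsHypothesis.ValiantsHypothesis.Theorems.RunbookKPTT
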